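import Literature.Barriers.ValiantsHypothesis.SensitiveDiscrepancy
import Literature.Barriers.ValiantsHypothesis.UniversalDistributionCount
import Mathlib.Analysis.SpecialFunctions.Pow.Real
import Mathlib.Analysis.SpecialFunctions.Log.Basic
import HarnessLib

/-!
# The monotone gap: proof of the `ε`-sensitive lower bound `CDGM2022_sensitive`

Discharge of the named fact `Literature.Barriers.ValiantsHypothesis.CDGM2022_sensitive` of
`MonotoneGap.lean` — the second main theorem of Chattopadhyay–Datta–Ghosal–Mukhopadhyay,
*Monotone complexity of spanning tree polynomial re-visited* (ITCS 2022, arXiv:2109.06941, §1;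
proof in §6): "There exists a constant `η > 0` such that both the polynomials
`F_{n-1,n} - ε·ST_n` and `F_{n-1,n} + ε·ST_n` have monotone circuit complexity `2^{Ω(n)}`
provided `ε ≥ 2^{-ηn}`" — in the tree's rendering: there are `η, c > 0` and `N₀` such that for
`N ≥ N₀`, `2^{-ηN} ≤ ε < 1`, every monotone computation of `sensitiveSTPoly N ε sub` has size
`≥ 2^{cN}`.

**Proof** (CDGM §6: "set `f = ST_n` ... `disc_Δ(C^f) = 2^{-η₀ n}` ... choosing
`ε = 2^{-η₀ n/10}` satisfies `ε ≥ 6γ/(1-3γ)` ... the monotone complexity of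
`F_{n-1,n} - ε·ST_n` is at least `ε/(3γ) = 2^{Ω(n)}`"), assembled from the sibling files:

* `SensitiveDiscrepancy.size_bound_of_discrepancy` (§4 + Thm. 2.1 of
  `Computability/AlgebraicComplexity/MonotoneStructure.lean`): a signed weight with rectangle
  discrepancy `γ` forces `ε/(6γ) ≤ 4·size·(N+1)²`;
* `UniversalDistributionCount.abs_rectSum_le_discGamma` / `discGamma_le_exp` (§5, with
  `SpanningTreeGadget.lean` and `Computability/Complexity/LindseyLemma.lean`): the universal
  weight `univWeight k N`, `k = ⌊N/40000⌋`, has `γ ≤ e·e^{-a₀N}`, `a₀ = 1/(4·10⁷)`;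
* elementary asymptotics (`exists_mul_sq_le_exp`: `C(N+1)² ≤ e^{aN}` eventually, from
  `x³/3! ≤ eˣ`; `2^t ≤ eᵗ`, `e^{-t} ≤ 2^{-t}`).

With `ε ≥ 2^{-ηN} ≥ e^{-ηN}`, `η = a₀/4`: `8γ ≤ ε` and `γ ≤ 1/12` for large `N`, so
`6γ ≤ ε(1-3γ)`; then `size ≥ ε/(24γ(N+1)²) ≥ e^{3a₀N/4}/(24e(N+1)²) ≥ e^{a₀N/4} ≥ 2^{a₀N/4}`.
Constants: `η = c = a₀/4 = 1/(16·10⁷)`; `N₀` is the maximum of `40000` and three explicit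
thresholds. Over `ℝ≥0` every circuit is monotone, so only fan-in two and `Computes` of
`IsMonotoneComputation` are used.

## References

* [ChattopadhyayDattaGhosalMukhopadhyay2022] §1 (second main theorem), §6 (its proof), §4, §5.
-/

noncomputable section

namespace Literature.Barriers.ValiantsHypothesis

open Literature.Computability.AlgebraicComplexity Finset
open scoped NNReal

/-! ### Elementary asymptotics -/

/-- Quadratic versus exponential growth, with an explicit threshold: for `a > 0` and every `C`,
`C (N+1)² ≤ e^{aN}` for all `N ≥ ⌈24|C|/a³⌉ + 1` (from `x³/3! ≤ eˣ`). [folklore] -/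
theorem exists_mul_sq_le_exp (a : ℝ) (ha : 0 < a) (C : ℝ) :
    ∃ N₀ : ℕ, ∀ N : ℕ, N₀ ≤ N → C * ((N : ℝ) + 1) ^ 2 ≤ Real.exp (a * N) := by
  refine ⟨Nat.ceil (24 * |C| / a ^ 3) + 1, fun N hN => ?_⟩
  have hN1 : (1 : ℝ) ≤ N := by exact_mod_cast le_trans (Nat.le_add_left 1 _) hN
  have hNge : 24 * |C| / a ^ 3 ≤ N :=
    (Nat.le_ceil _).trans (by exact_mod_cast Nat.le_of_succ_le hN)
  have h24 : 24 * |C| ≤ a ^ 3 * N := by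
    rw [div_le_iff₀ (by positivity)] at hNge; linarith
  have h3 : (a * N) ^ 3 / 6 ≤ Real.exp (a * N) := by
    have := Real.pow_div_factorial_le_exp (x := a * N) (by positivity) 3
    norm_num [Nat.factorial] at this
    exact this
  have hC := abs_nonneg C
  calc C * ((N : ℝ) + 1) ^ 2 ≤ |C| * ((N : ℝ) + 1) ^ 2 :=
        mul_le_mul_of_nonneg_right (le_abs_self C) (by positivity)
    _ ≤ |C| * (4 * (N : ℝ) ^ 2) := mul_le_mul_of_nonneg_left (by nlinarith) hC
    _ ≤ (a * N) ^ 3 / 6 := by nlinarith [mul_nonneg hC (sq_nonneg (N : ℝ))]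
    _ ≤ Real.exp (a * N) := h3

/-- `e^{-t} ≤ 2^{-t}` for `t ≥ 0` (as `log 2 ≤ 1`). [folklore] -/
theorem exp_neg_le_two_rpow_neg {t : ℝ} (ht : 0 ≤ t) : Real.exp (-t) ≤ (2 : ℝ) ^ (-t) := by
  rw [Real.rpow_def_of_pos two_pos]
  apply Real.exp_le_exp.2
  have h1 : Real.log 2 ≤ 1 := by
    have := Real.log_le_sub_one_of_pos (x := 2) two_pos; linarith
  nlinarith [Real.log_nonneg (x := 2) one_le_two]

/-- `2^{t} ≤ e^{t}` for `t ≥ 0`. [folklore] -/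
theorem two_rpow_le_exp {t : ℝ} (ht : 0 ≤ t) : (2 : ℝ) ^ t ≤ Real.exp t := by
  rw [Real.rpow_def_of_pos two_pos]
  apply Real.exp_le_exp.2
  have h1 : Real.log 2 ≤ 1 := by
    have := Real.log_le_sub_one_of_pos (x := 2) two_pos; linarith
  nlinarith [Real.log_nonneg (x := 2) one_le_two]

/-! ### The theorem -/

/-- **CDGM 2022, second main theorem, proved** (`ε`-sensitive lower bound for
`F_{n-1,n} ∓ ε·ST_n`): discharge of the named fact `CDGM2022_sensitive` of `MonotoneGap.lean`.
Assembly of: the structure theorem (`MonotoneStructure.lean`, CDGM Thm. 2.1), the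
Discrepancy–Sensitivity Correspondence (`SensitiveDiscrepancy.lean`, CDGM §4), the gadget and
Claim 5.1 (`SpanningTreeGadget.lean`, §5.1), Lindsey's lemma (`LindseyLemma.lean`, Thm. 2.2) and
the universal distribution with its discrepancy bound `γ ≤ e · e^{-N/(4·10⁷)}`
(`UniversalDistribution*.lean`, §5.2–5.3, Lemma 5.2), as in CDGM §6: "choosing
`ε = 2^{-η₀ n/10}` satisfies `ε ≥ 6γ/(1-3γ)` ... the monotone complexity ... is at least
`ε/(3γ) = 2^{Ω(n)}`". Constants: `η = c = 1/(16·10⁷)` (natural-log rate converted to base 2).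
[cite: ChattopadhyayDattaGhosalMukhopadhyay2022, §1 (second main theorem) and §6 (its proof)] -/
theorem CDGM2022_sensitive_holds : CDGM2022_sensitive := by
  -- the rate of decay of γ and the three thresholds
  set a₀ : ℝ := 1 / (4 * 10 ^ 7) with ha₀
  have ha₀pos : 0 < a₀ := by rw [ha₀]; norm_num
  obtain ⟨N₁, hN₁⟩ := exists_mul_sq_le_exp (3 * a₀ / 4) (by positivity) (8 * Real.exp 1)
  obtain ⟨N₂, hN₂⟩ := exists_mul_sq_le_exp a₀ ha₀pos (12 * Real.exp 1)
  obtain ⟨N₃, hN₃⟩ := exists_mul_sq_le_exp (a₀ / 2) (by positivity) (24 * Real.exp 1)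
  refine ⟨a₀ / 4, by positivity, a₀ / 4, by positivity, max (max N₁ N₂) (max N₃ 40000), ?_⟩
  intro N hN ε hε hε1 sub P hP
  have hN1 : N₁ ≤ N := le_trans (le_trans (le_max_left _ _) (le_max_left _ _)) hN
  have hN2 : N₂ ≤ N := le_trans (le_trans (le_max_right _ _) (le_max_left _ _)) hN
  have hN3 : N₃ ≤ N := le_trans (le_trans (le_max_left _ _) (le_max_right _ _)) hN
  have hN4 : 40000 ≤ N := le_trans (le_trans (le_max_right _ _) (le_max_right _ _)) hN
  have hNpos : (0 : ℝ) < N := by exact_mod_cast (show 0 < N by omega)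
  -- the parameters of the universal distribution
  set k := N / 40000 with hk
  have hk1 : 1 ≤ k := by omega
  have hkN : 40000 * k ≤ N := by omega
  have hNk : N < 40000 * (k + 1) := by omega
  have hfit : 4 * k + 2 ≤ N := by omega
  set γ := discGamma k N with hγdef
  have hγpos : 0 < γ := discGamma_pos hfit
  have hγle : γ ≤ Real.exp 1 * Real.exp (-(N : ℝ) / (4 * 10 ^ 7)) := discGamma_le_exp hk1 hkN hNk
  have hγle' : γ ≤ Real.exp 1 * Real.exp (-(a₀ * N)) := by
    convert hγle using 3; rw [ha₀]; ring
  have hZ := sum_abs_univWeight_pos (k := k) (N := N) hfit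
  -- ε ≥ e^{-(a₀/4) N}
  have hε0 : (0 : ℝ) ≤ ε := NNReal.coe_nonneg ε
  have hεexp : Real.exp (-(a₀ / 4 * N)) ≤ ε :=
    (exp_neg_le_two_rpow_neg (by positivity)).trans hε
  -- 8γ ≤ ε and γ ≤ 1/12
  have hE1 := hN₁ N hN1   -- 8e (N+1)² ≤ exp (3a₀/4 N)
  have hE2 := hN₂ N hN2   -- 12e (N+1)² ≤ exp (a₀ N)
  have hE3 := hN₃ N hN3   -- 24e (N+1)² ≤ exp (a₀/2 N)
  have hsq1 : (1 : ℝ) ≤ ((N : ℝ) + 1) ^ 2 := by nlinarith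
  have hepos : 0 < Real.exp 1 := Real.exp_pos 1
  have h8 : 8 * γ ≤ ε := by
    have h1 : 8 * Real.exp 1 ≤ Real.exp (3 * a₀ / 4 * N) :=
      le_trans (by nlinarith) hE1
    calc 8 * γ ≤ 8 * (Real.exp 1 * Real.exp (-(a₀ * N))) := by linarith
      _ = (8 * Real.exp 1) * Real.exp (-(a₀ * N)) := by ring
      _ ≤ Real.exp (3 * a₀ / 4 * N) * Real.exp (-(a₀ * N)) :=
          mul_le_mul_of_nonneg_right h1 (Real.exp_pos _).le
      _ = Real.exp (-(a₀ / 4 * N)) := by rw [← Real.exp_add]; congr 1; ring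
      _ ≤ ε := hεexp
  have h12 : γ ≤ 1 / 12 := by
    have h1 : 12 * Real.exp 1 ≤ Real.exp (a₀ * N) := le_trans (by nlinarith) hE2
    have h2 : Real.exp (a₀ * N) * Real.exp (-(a₀ * N)) = 1 := by
      rw [← Real.exp_add, add_neg_cancel, Real.exp_zero]
    have h3 : 12 * (Real.exp 1 * Real.exp (-(a₀ * N))) ≤ 1 := by
      calc 12 * (Real.exp 1 * Real.exp (-(a₀ * N))) = (12 * Real.exp 1) * Real.exp (-(a₀ * N)) := by ring
        _ ≤ Real.exp (a₀ * N) * Real.exp (-(a₀ * N)) :=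
            mul_le_mul_of_nonneg_right h1 (Real.exp_pos _).le
        _ = 1 := h2
    linarith
  have hεγ : 6 * γ ≤ ε * (1 - 3 * γ) := by nlinarith
  -- the size bound from the Discrepancy–Sensitivity Correspondence
  have hsize := size_bound_of_discrepancy (N := N) (by omega) (univWeight k N) (γ := γ)
    (fun ν h => univWeight_nonneg h) (fun ν h => univWeight_nonpos h) hZ
    (fun A h1 h2 S T => abs_rectSum_le_discGamma A (le_of_lt h1) h2 S T)
    hε1 hγpos hεγ sub P hP.1 hP.2.2
  -- conclude
  set s : ℝ := 4 * P.size * ((N : ℝ) + 1) ^ 2 with hs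
  have hs' : (ε : ℝ) / (6 * γ) ≤ s := hsize
  have hmain : Real.exp (a₀ / 4 * N) ≤ P.size := by
    -- ε ≤ 6 γ s ≤ 6 e e^{-a₀N} s, and ε ≥ e^{-a₀N/4}
    have h1 : (ε : ℝ) ≤ 6 * γ * s := by
      rwa [div_le_iff₀ (by positivity), mul_comm] at hs'
    have h2 : Real.exp (-(a₀ / 4 * N)) ≤ 6 * (Real.exp 1 * Real.exp (-(a₀ * N))) * s := by
      have hs0 : 0 ≤ s := by positivity
      calc Real.exp (-(a₀ / 4 * N)) ≤ ε := hεexp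
        _ ≤ 6 * γ * s := h1
        _ ≤ 6 * (Real.exp 1 * Real.exp (-(a₀ * N))) * s := by
            apply mul_le_mul_of_nonneg_right _ hs0; linarith
    -- multiply by e^{a₀ N}: e^{3a₀N/4} ≤ 6 e s = 24 e (N+1)² size
    have h3 : Real.exp (3 * a₀ / 4 * N) ≤ 24 * Real.exp 1 * ((N : ℝ) + 1) ^ 2 * P.size := by
      have hmul := mul_le_mul_of_nonneg_right h2 (Real.exp_pos (a₀ * N)).le
      have e1 : Real.exp (-(a₀ / 4 * N)) * Real.exp (a₀ * N) = Real.exp (3 * a₀ / 4 * N) := by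
        rw [← Real.exp_add]; congr 1; ring
      have e2 : 6 * (Real.exp 1 * Real.exp (-(a₀ * N))) * s * Real.exp (a₀ * N) =
          24 * Real.exp 1 * ((N : ℝ) + 1) ^ 2 * P.size := by
        have : Real.exp (-(a₀ * N)) * Real.exp (a₀ * N) = 1 := by
          rw [← Real.exp_add, neg_add_cancel, Real.exp_zero]
        rw [hs]
        calc 6 * (Real.exp 1 * Real.exp (-(a₀ * N))) * (4 * P.size * ((N : ℝ) + 1) ^ 2) * Real.exp (a₀ * N)
            = 24 * Real.exp 1 * ((N : ℝ) + 1) ^ 2 * P.size * (Real.exp (-(a₀ * N)) * Real.exp (a₀ * N)) := by ring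
          _ = _ := by rw [this, mul_one]
      rw [e1, e2] at hmul
      exact hmul
    -- and 24 e (N+1)² ≤ e^{a₀ N /2}
    have h4 : 24 * Real.exp 1 * ((N : ℝ) + 1) ^ 2 * P.size ≤ Real.exp (a₀ / 2 * N) * P.size :=
      mul_le_mul_of_nonneg_right hE3 (Nat.cast_nonneg _)
    have h5 : Real.exp (3 * a₀ / 4 * N) = Real.exp (a₀ / 2 * N) * Real.exp (a₀ / 4 * N) := by
      rw [← Real.exp_add]; congr 1; ring
    have h6 : Real.exp (a₀ / 2 * N) * Real.exp (a₀ / 4 * N) ≤ Real.exp (a₀ / 2 * N) * P.size := by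
      rw [← h5]; exact h3.trans h4
    exact le_of_mul_le_mul_left h6 (Real.exp_pos _)
  calc (2 : ℝ) ^ (a₀ / 4 * N) ≤ Real.exp (a₀ / 4 * N) := two_rpow_le_exp (by positivity)
    _ ≤ P.size := hmain

end Literature.Barriers.ValiantsHypothesis
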